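import Summits.PneNP.PneNP.Theorems.SymmetryBudgetNoHiddenOrderPerPathHeight

/-!
# The label budget is linear: timed paths are `ORSteps` (`NoHiddenOrder`, PER-PATH.md §12, brick B4 completed)

Route `PneNP/SymmetryBudget`, `NoHiddenOrder` (stmt-PneNP-14781). The timed path of OR-choices of the components-only
Corneil–Goldberg process (`timed`, `IsORChoice`, `…PerPathReplay.lean`) started at an OR-node `St` (colouring equitable inside the
block, switching graph connected) is an `ORSteps` (`…PerPathProcess.lean`) with branching numbers `d_k = |smallestCell_k|`
(`toORSteps`). Consequently:

* `sum_log_smallestCell_le` — `Σ_{k<t} ⌊log₂ |smallestCell_k|⌋ ≤ 4|V| + ⌊log₂|V|⌋` along every such path (`ORSteps.sum_log_d_le`);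
* `length_le_card` — `t ≤ |V|` (the OR-choices are distinct vertices);
* **`sum_codeLen_heightLabel_le_linear`** — the height label of the path (`…PerPathHeight.lean`) has total code length
  `Σ_{k<t} (2⌊log₂ label(x_k)⌋ + 1) ≤ 9|V| + 2⌊log₂|V|⌋`.

With `AdviceEntropy.factorial_le_advice_bound` (seat 0) this bounds the number of height labels of window paths by
`2^{O(g)}`: every node of the recursion tree is the exact replay (`replay_root`) of a label from a family of polynomial size in
`m = 2^g` — the entropy half of Theorem A of the memo, now kernel-checked for the real process. One definition (`toORSteps`).
-/

-- `Summit.PneNP.PneNP.…` duplicates `PneNP` BY DESIGN (single-problem summit, D-0017 layout).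
set_option linter.dupNamespace false

namespace Summit.PneNP.PneNP.Theorems

open Finset

namespace BranchSum

variable {V : Type*} [DecidableEq V] {G : SimpleGraph V} [DecidableRel G.Adj]
variable {v : V} {St : Finset V × (V → ℕ)} {x : ℕ → V} {t : ℕ}

/-- The pointer stays in every block of its timed path. -/
theorem self_mem_timed (hvSt : v ∈ St.1) (k : ℕ) : v ∈ (timed G v St x k).1 := by
  induction k with
  | zero => exact hvSt
  | succ k ih => exact self_mem_atom _ ih

variable (G)

/-- **The timed path is an `ORSteps`** with `d k = |smallestCell_k|` (for `k < t`), pointer `v` throughout, and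
`colStar k = col (k+1)`. Root hypotheses: the start colouring is equitable inside the start block, whose switching graph is
connected. -/
noncomputable def toORSteps (hOR : IsORChoice G v St x t) (hv : ∀ k, k < t → x k ≠ v) (hvSt : v ∈ St.1)
    (heq0 : ∀ u ∈ St.1, ∀ w ∈ St.1, St.2 u = St.2 w → ∀ y ∈ St.1,
      ((cellOf St.1 St.2 y).filter fun z => G.Adj u z).card = ((cellOf St.1 St.2 y).filter fun z => G.Adj w z).card)
    (hconn0 : ∀ S ⊆ St.1, S.Nonempty → S ≠ St.1 → ∃ a ∈ S, ∃ b ∈ St.1 \ S, (swGraph G St.1 St.2).Adj a b) :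
    ORSteps G t where
  W k := if k < t then (timed G v St x k).1 else ∅
  col k := (timed G v St x k).2
  colStar k := (timed G v St x (k + 1)).2
  d k := (smallestCell (timed G v St x k).1 (timed G v St x k).2).card
  x := x
  p _ := v
  finalW k hk := by simp only [show ¬ k < t from Nat.not_lt.2 hk, if_false]
  two_le_W k hk := by simp only [hk, if_true]; exact (hOR k hk).1
  equitable0 := by
    by_cases ht : 0 < t
    · simp only [ht, if_true]; exact heq0
    · simp only [ht, if_false]; intro u hu; exact absurd hu (notMem_empty u)
  connected0 := by
    by_cases ht : 0 < t
    · simp only [ht, if_true]; exact hconn0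
    · simp only [ht, if_false]; intro S hS hSne; obtain ⟨s, hs⟩ := hSne; exact absurd (hS hs) (notMem_empty s)
  d_le k u hu := by
    by_cases hk : k < t
    · simp only [hk, if_true] at hu ⊢; exact card_smallestCell_le _ hu
    · simp only [hk, if_false] at hu; exact absurd hu (notMem_empty u)
  star_refines k u hu w hw h := by
    by_cases hk : k < t
    · simp only [hk, if_true] at hu hw
      exact indiv_refines _ _ (refineIn_refines (G := G) _ hu hw h)
    · simp only [hk, if_false] at hu; exact absurd hu (notMem_empty u)
  star_equitable k hk u hu w hw h y hy := by
    have hk' : k < t := by omega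
    simp only [hk', if_true] at hu hw hy ⊢
    exact equitableIn_refineIn (G := G) _ _ hu hw h hy
  x_mem k hk := by
    have hk' : k < t := by omega
    simp only [hk', if_true]; exact smallestCell_subset _ _ (hOR k hk').2
  p_mem k hk := by
    have hk' : k < t := by omega
    simp only [hk', if_true]; exact self_mem_timed hvSt k
  x_ne_p k hk := hv k (by omega)
  star_single k hk := by
    have hk' : k < t := by omega
    simp only [hk', if_true]
    exact cellOf_refineIn_indiv _ (smallestCell_subset _ _ (hOR k hk').2)
  nextW k hk := by
    have hk' : k < t := by omega
    simp only [hk, hk', if_true]; rfl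
  col_succ k _ := rfl

variable {G}

section Linear

variable [Fintype V] (hOR : IsORChoice G v St x t) (hv : ∀ k, k < t → x k ≠ v) (hvSt : v ∈ St.1)
  (heq0 : ∀ u ∈ St.1, ∀ w ∈ St.1, St.2 u = St.2 w → ∀ y ∈ St.1,
    ((cellOf St.1 St.2 y).filter fun z => G.Adj u z).card = ((cellOf St.1 St.2 y).filter fun z => G.Adj w z).card)
  (hconn0 : ∀ S ⊆ St.1, S.Nonempty → S ≠ St.1 → ∃ a ∈ S, ∃ b ∈ St.1 \ S, (swGraph G St.1 St.2).Adj a b)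
include hOR hv hvSt heq0 hconn0

/-- **Linear per-path bound for the smallest cells of a timed path**: `Σ_{k<t} ⌊log₂ |smallestCell_k|⌋ ≤ 4|V| + ⌊log₂|V|⌋`. -/
theorem sum_log_smallestCell_le :
    ∑ k ∈ range t, Nat.log 2 (smallestCell (timed G v St x k).1 (timed G v St x k).2).card ≤
      4 * Fintype.card V + Nat.log 2 (Fintype.card V) :=
  (toORSteps G hOR hv hvSt heq0 hconn0).sum_log_d_le

omit hvSt heq0 hconn0 in
/-- A timed path has at most `|V|` OR-choices (they are distinct vertices). -/
theorem length_le_card : t ≤ Fintype.card V := by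
  have hinj : Set.InjOn x ↑(range t) := fun i hi j hj hij =>
    x_injective hOR hv (mem_range.1 (mem_coe.1 hi)) (mem_range.1 (mem_coe.1 hj)) hij
  have := card_le_univ ((range t).image x)
  rw [card_image_of_injOn hinj, card_range] at this
  exact this

/-- **The height label of a timed path has linear code length**:
`Σ_{k<t} (2⌊log₂ heightLabel (x k)⌋ + 1) ≤ 9|V| + 2⌊log₂|V|⌋`. -/
theorem sum_codeLen_heightLabel_le_linear :
    ∑ k ∈ range t, (2 * Nat.log 2 (heightLabel G v St x t (x k)) + 1) ≤ 9 * Fintype.card V + 2 * Nat.log 2 (Fintype.card V) := by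
  have h1 := sum_codeLen_heightLabel_le hOR hv
  have h2 := sum_log_smallestCell_le hOR hv hvSt heq0 hconn0
  have h3 := length_le_card hOR hv
  omega

end Linear

end BranchSum

end Summit.PneNP.PneNP.Theorems
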